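import Mathlib
import Summits.ResolutionOfSingularities.ResolutionOfSingularities.Theorems.WeightedInvariantLocalWeightedDropNCResSettingPermissible
import Summits.ResolutionOfSingularities.ResolutionOfSingularities.Theorems.WeightedInvariantLocalWeightedDropNCToricRung

/-!
# `LocalWeightedDrop`, the NC count game — TOT2-LINE piece S-SET (9): **LETTER CENTRES — THE IDENTITY MOVE WITH AN INDICATOR WEIGHT**

[OURS · L1 W4.3 · chain w43, engine crux `LocalWeightedDrop` stmt-ResolutionOfSingularities-8899; sub-line under the v32 registered stub
`stub_spaceNCRankDrop`, design memo `L/res-L1-w43-lead-1/g4/TOT2-LINE.md` v1.1 (C)/(D) (the curve moves `V(y,u₁)`, `V(y,u₂)` of a fundamental unit are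
LETTER CENTRES in prepared coordinates), piece S-SET = res-L1-w43-stub-1; objects of `…NCResSettingDefs` (p528587).  Nothing here is a statement
of any manuscript.]

* `weightedOrder_X_indicator` — the indicator weight of the letter `x_l` is `1` on `S` and `0` off `S`;
* `isBPermissible_X_indicator` — the identity move with centre `C = V(x_l : l ∈ S)` (`S` non-empty) is B-permissible for `δ` iff-style sufficient
  conditions: `O ⊆ S` (the centre lies in every old component) and `f ∈ 𝔭_C^{ord f}` (equimultiplicity, stated with `weightedOrder`);
* `isBPermissible_X_indicator_iff` — and these conditions are also necessary.
-/

set_option linter.dupNamespace false -- mandated namespace of this single-conjunct summit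

noncomputable section

namespace Summit.ResolutionOfSingularities.ResolutionOfSingularities.Theorems

namespace TameFourTupleDrop

open MvPowerSeries Literature.AlgebraicGeometry.Resolution

variable {k : Type} [Field k] {m : ℕ}

/-- The indicator weight of a letter. -/
theorem weightedOrder_X_indicator (S : Finset (Fin (m + 1))) (l : Fin (m + 1)) :
    (X l : MvPowerSeries (Fin (m + 1)) k).weightedOrder (fun j => if j ∈ S then 1 else 0) = if l ∈ S then (1 : ℕ∞) else 0 := by
  classical
  rw [X_def, weightedOrder_monomial_of_ne_zero (w := fun j => if j ∈ S then 1 else 0) (one_ne_zero' k), Finsupp.weight_single]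
  split_ifs <;> simp

/-- **THE IDENTITY MOVE WITH A LETTER CENTRE IS B-PERMISSIBLE** when the centre `C = V(x_l : l ∈ S)` lies inside every old component (`O ⊆ S`)
and `f` is equimultiple along it (`ord f ≤ weightedOrder_{𝟙_S} f`, i.e. `f ∈ 𝔭_C^{ord f}`). -/
theorem isBPermissible_X_indicator (δ : Decoration k m) {S : Finset (Fin (m + 1))} (hS : S.Nonempty) (hO : δ.O ⊆ S)
    (hP1 : δ.f.order ≤ δ.f.weightedOrder (fun j => if j ∈ S then 1 else 0)) :
    IsBPermissible δ (fun j => (X j : MvPowerSeries (Fin (m + 1)) k)) (fun j => if j ∈ S then 1 else 0) := by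
  have hX : subst (fun j => (X j : MvPowerSeries (Fin (m + 1)) k)) δ.f = δ.f := congrFun subst_self δ.f
  refine ⟨NCTransport.isCountMove_X_indicator hS, by rw [hX]; exact hP1, fun l hl => ?_, fun l _ => ⟨l, 1, by rw [map_one]; exact one_ne_zero, by rw [one_mul]⟩⟩
  rw [weightedOrder_X_indicator, if_pos (hO hl)]

/-- Conversely the two conditions are necessary. -/
theorem isBPermissible_X_indicator_iff (δ : Decoration k m) {S : Finset (Fin (m + 1))} (hS : S.Nonempty) :
    IsBPermissible δ (fun j => (X j : MvPowerSeries (Fin (m + 1)) k)) (fun j => if j ∈ S then 1 else 0) ↔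
      δ.O ⊆ S ∧ δ.f.order ≤ δ.f.weightedOrder (fun j => if j ∈ S then 1 else 0) := by
  have hX : subst (fun j => (X j : MvPowerSeries (Fin (m + 1)) k)) δ.f = δ.f := congrFun subst_self δ.f
  constructor
  · rintro ⟨-, hP1, hP2, -⟩
    refine ⟨fun l hl => ?_, by rwa [hX] at hP1⟩
    have h := hP2 l hl
    rw [weightedOrder_X_indicator] at h
    by_contra hlS
    rw [if_neg hlS] at h
    exact absurd h (by simp)
  · rintro ⟨hO, hP1⟩
    exact isBPermissible_X_indicator δ hS hO hP1


end TameFourTupleDrop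

end Summit.ResolutionOfSingularities.ResolutionOfSingularities.Theorems

end
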